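import Summits.Ventures.PercRepro.C041BlockMapMultilinear

/-!
# ROW C-041 — THE MIRROR: exchanging the two mark types is a symmetry of the cone, of the triangle map and of every
block map (p6, gen 34)

The MIRROR `mirror w = (L₀, L₂, L₁, M₀, M₂, M₁)` exchanges the two mark types.  It is an involutive linear
ring automorphism of the six-vectors (`mirror_mul`, `mirror_one`, `mirror_add`, `mirror_smul`), sends the
generator `v a` to `v (1 − a)` and the pure root `V a` to `V (1 − a)` (`mirror_v`, `mirror_V`), hence preserves
the cone (`InCone_mirror`) and (P) (`K4v_mirror`); it commutes with `θ_B`, `θ_R`, `ℓψ`, `exitOf`, with the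
triangle map (`thetaTri_mirror`) and with every block map (`blockMap_mirror`).  CONSEQUENCE — every cone theorem
of the row has a free twin with the mark types exchanged: `InCone_thetaTri_mirror`, and for the seeds of mine-3's
§21 (ao)–(aw), **the `v 0`-seed follows from the `v 1`-seed** (`InCone_thetaTri_v0_of_v1`, in full and on any
family of second arguments closed under the mirror: `InCone_thetaTri_v0_V_of_v1`).
-/

namespace PercRepro

namespace TreeClosure

/-! ## The mirror -/

/-- The MIRROR of a six-vector: the two mark types exchanged, coordinates `1 ↔ 2` and `4 ↔ 5`. -/
def mirror (w : Vec6) : Vec6 := ![w 0, w 2, w 1, w 3, w 5, w 4]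

/-- The mirror is an involution. -/
theorem mirror_mirror (w : Vec6) : mirror (mirror w) = w := by
  funext i
  fin_cases i <;> rfl

/-- The mirror is additive. -/
theorem mirror_add (x y : Vec6) : mirror (x + y) = mirror x + mirror y := by
  funext i
  fin_cases i <;> rfl

/-- The mirror is homogeneous. -/
theorem mirror_smul (c : ℝ) (x : Vec6) : mirror (c • x) = c • mirror x := by
  funext i
  fin_cases i <;> rfl

/-- The mirror is multiplicative. -/
theorem mirror_mul (x y : Vec6) : mirror (x * y) = mirror x * mirror y := by
  funext i
  fin_cases i <;> rfl

/-- The mirror fixes `𝟙`. -/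
theorem mirror_one : mirror (1 : Vec6) = 1 := by
  funext i
  fin_cases i <;> rfl

/-- The mirror of a finite product. -/
theorem mirror_prod {κ : Type} (s : Finset κ) (f : κ → Vec6) : mirror (∏ k ∈ s, f k) = ∏ k ∈ s, mirror (f k) := by
  classical
  induction s using Finset.induction_on with
  | empty => simp only [Finset.prod_empty, mirror_one]
  | insert k s hks ih => rw [Finset.prod_insert hks, Finset.prod_insert hks, mirror_mul, ih]

/-- The mirror of a finite sum. -/
theorem mirror_sum {κ : Type} (s : Finset κ) (f : κ → Vec6) : mirror (∑ k ∈ s, f k) = ∑ k ∈ s, mirror (f k) := by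
  classical
  induction s using Finset.induction_on with
  | empty =>
    simp only [Finset.sum_empty]
    funext i
    fin_cases i <;> rfl
  | insert k s hks ih => rw [Finset.sum_insert hks, Finset.sum_insert hks, mirror_add, ih]

/-! ## The mirror on the generators and the cone -/

/-- The mirror of a generator is the generator of the complementary fugacity. -/
theorem mirror_v (a : ℝ) : mirror (v a) = v (1 - a) := by
  refine ZoneZ.TwoExit.vec6_ext _ _ ?_ ?_ ?_ ?_ ?_ ?_
  · rfl
  · rfl
  · show 1 + a ^ 2 = 1 + (1 - (1 - a)) ^ 2
    ring
  · show a * (1 - a) = (1 - a) * (1 - (1 - a))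
    ring
  · rfl
  · show a = 1 - (1 - a)
    ring

/-- The mirror of a pure root is the pure root of the complementary fugacities. -/
theorem mirror_V {m : ℕ} (a : Fin m → ℝ) : mirror (V a) = V fun i => 1 - a i := by
  unfold V
  rw [mirror_prod]
  simp only [mirror_v]

/-- **The cone is mirror-symmetric.** -/
theorem InCone_mirror {w : Vec6} (h : InCone w) : InCone (mirror w) := by
  induction h with
  | pure a ha =>
    rw [mirror_V]
    exact InCone.pure _ fun i => ⟨by linarith [(ha i).2], by linarith [(ha i).1]⟩
  | add _ _ ihx ihy =>
    rw [mirror_add]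
    exact ihx.add ihy
  | smul c hc _ ih =>
    rw [mirror_smul]
    exact ih.smul c hc

/-- Cone membership is mirror-invariant. -/
theorem InCone_mirror_iff (w : Vec6) : InCone (mirror w) ↔ InCone w :=
  ⟨fun h => by simpa [mirror_mirror] using InCone_mirror h, InCone_mirror⟩

/-- `𝒦` is symmetric in the two types. -/
theorem K4_swap {g t1 t2 k : ℝ} : K4 g t2 t1 k ↔ K4 g t1 t2 k := by
  constructor
  · rintro ⟨h1, h2, h3, h4, h5⟩
    exact ⟨h2, h1, h3, h4, by rw [mul_comm]; exact h5⟩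
  · rintro ⟨h1, h2, h3, h4, h5⟩
    exact ⟨h2, h1, h3, h4, by rw [mul_comm]; exact h5⟩

/-- (P) is mirror-symmetric. -/
theorem K4v_mirror (w : Vec6) : K4v (mirror w) ↔ K4v w := by
  unfold K4v
  simp only [mirror, Matrix.cons_val]
  rw [add_comm (w 5) (w 4)]
  exact K4_swap

/-! ## The mirror commutes with the row's maps -/

/-- The mirror commutes with `θ_B`. -/
theorem thB_mirror (w : Vec6) : thB (mirror w) = mirror (thB w) := by
  funext i
  fin_cases i <;> rfl

/-- The mirror commutes with `θ_R`. -/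
theorem thR_mirror (w : Vec6) : thR (mirror w) = mirror (thR w) := by
  funext i
  fin_cases i <;> simp [thR, mirror, nAdm, kInv] <;> ring

/-- The mirror commutes with `ℓψ`. -/
theorem ellv_mirror (w : Vec6) : ellv (mirror w) = mirror (ellv w) := by
  funext i
  fin_cases i <;> simp [ellv, ell, mirror] <;> ring

/-- The mirror commutes with the joint vector of a product. -/
theorem thR_mirror_mul (x y : Vec6) : thR (mirror x * mirror y) = mirror (thR (x * y)) := by
  rw [← mirror_mul, thR_mirror]

/-- The mirror commutes with every colouring row of the triangle. -/
theorem triCol_mirror (w w' : Vec6) (e₁ e₂ e₃ : Bool) :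
    triCol (mirror w) (mirror w') e₁ e₂ e₃ = mirror (triCol w w' e₁ e₂ e₃) := by
  cases e₁ <;> cases e₂ <;> cases e₃ <;>
    simp only [triCol, thB_mirror, thR_mirror, thR_mirror_mul, mirror_mul]

/-- **The mirror commutes with the triangle map.** -/
theorem thetaTri_mirror (w w' : Vec6) : thetaTri (mirror w) (mirror w') = mirror (thetaTri w w') := by
  unfold thetaTri
  rw [mirror_sum]
  refine Finset.sum_congr rfl fun e₁ _ => ?_
  rw [mirror_sum]
  refine Finset.sum_congr rfl fun e₂ _ => ?_
  rw [mirror_sum]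
  refine Finset.sum_congr rfl fun e₃ _ => ?_
  exact triCol_mirror w w' e₁ e₂ e₃

/-- **Every cone theorem of the triangle has its mirror.** -/
theorem InCone_thetaTri_mirror {w w' : Vec6} (h : InCone (thetaTri w w')) :
    InCone (thetaTri (mirror w) (mirror w')) := by
  rw [thetaTri_mirror]
  exact InCone_mirror h

/-- **The `v 0`-seed from the `v 1`-seed**: if `θ_△(v 1, w) ∈ cone` for every cone element `w`, then
`θ_△(v 0, w) ∈ cone` for every cone element `w`. -/
theorem InCone_thetaTri_v0_of_v1 (h : ∀ w, InCone w → InCone (thetaTri (v 1) w)) (w : Vec6) (hw : InCone w) :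
    InCone (thetaTri (v 0) w) := by
  have := InCone_thetaTri_mirror (h (mirror w) (InCone_mirror hw))
  rwa [mirror_mirror, mirror_v, show (1 : ℝ) - 1 = 0 by norm_num] at this

/-- **The `v 0`-seed on the mirrored stars**: from `θ_△(v 1, V a) ∈ cone` at the star `a` follows
`θ_△(v 0, V (1 − a)) ∈ cone`. -/
theorem InCone_thetaTri_v0_V_of_v1 {m : ℕ} (a : Fin m → ℝ) (h : InCone (thetaTri (v 1) (V a))) :
    InCone (thetaTri (v 0) (V fun i => 1 - a i)) := by
  have := InCone_thetaTri_mirror h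
  rwa [mirror_v, mirror_V, show (1 : ℝ) - 1 = 0 by norm_num] at this

end TreeClosure

namespace ZoneZ

namespace MultiExit

open ZoneData Pendant Finset TwoExit TreeClosure

/-- The mirror commutes with `exitOf`. -/
theorem exitOf_mirror (w : Vec6) (r : Prop) : exitOf (mirror w) r = mirror (exitOf w r) := by
  unfold exitOf
  by_cases hr : r
  · rw [if_pos hr, if_pos hr]
  · rw [if_neg hr, if_neg hr, thB_mirror]

variable {ι V₁ E₁ U₁ U₂ : Type} (Z₁ : ZoneData V₁ E₁ U₁ U₂) (u : ι → V₁) (a₁ : V₁)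
variable [Fintype ι] [Fintype E₁] [DecidableEq E₁]

omit [Fintype E₁] [DecidableEq E₁] in
/-- The mirror commutes with every colouring term. -/
theorem colTerm_mirror (ω : E₁ → Bool) (w : ι → Vec6) :
    colTerm Z₁ u a₁ ω (fun k => mirror (w k)) = mirror (colTerm Z₁ u a₁ ω w) := by
  unfold colTerm
  rw [mirror_mul, mirror_prod, mirror_prod]
  simp only [exitOf_mirror, ← thR_mirror, mirror_prod]

/-- **The mirror commutes with every block map.** -/
theorem blockMap_mirror (w : ι → Vec6) :
    blockMap Z₁ u a₁ (fun k => mirror (w k)) = mirror (blockMap Z₁ u a₁ w) := by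
  rw [blockMap_eq_sum_colTerm, blockMap_eq_sum_colTerm, mirror_sum]
  exact Finset.sum_congr rfl fun ω _ => colTerm_mirror Z₁ u a₁ ω w

/-- **Every cone theorem of a block map has its mirror.** -/
theorem inCone_blockMap_mirror (w : ι → Vec6) (h : InCone (blockMap Z₁ u a₁ w)) :
    InCone (blockMap Z₁ u a₁ fun k => mirror (w k)) := by
  rw [blockMap_mirror]
  exact InCone_mirror h

end MultiExit

end ZoneZ

end PercRepro
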